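import Literature.Geometry.Lorentzian.TimelikeRayCauchy
import Literature.Geometry.Lorentzian.KerrConvergence
import Literature.Geometry.Lorentzian.KerrSchildCoord
import Literature.Geometry.Lorentzian.CauchyDevelopment
import Literature.Geometry.Lorentzian.OpensCausality

/-!
# Late charts carry immortal observers (stub `stub_immortalObservers`)

Registered stub `stub_immortalObservers` of the line `crush-the-swallowed-interior` of the crux
`TameCensorship` (route PhotonSphereChannels of the Final State Conjecture summit): a late chart
`Ψ` from a boosted Kerr–Schild background whose near-zone `C²` deviation tends to `0` pushes the
straight Killing orbit `s ↦ x₀ + s Λe₀` of a background point `x₀` at which `Λe₀` is timelike for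
the background form to a curve `γ` of the Cauchy development which is either eventually in
`J⁺(ιX)`, `≤`-monotone and of unbounded Lorentzian length, or eventually a past-directed timelike
curve.

Structure of the proof:
* the orbit has constant rest-frame Kerr–Schild radius and rest-frame time `t(x₀) + s`
  (`time_add_smul`, `radius_add_smul`), and the boosted Kerr–Schild form is stationary along it
  (`bilin_add_smul`, from `Kerr.bilin_add_smul_basisVector_zero`); so `x₀ + sΛe₀` lies in the
  truncated slab `{t = t(x₀) + s, r ≤ r(x₀)}`, on which `truncDeviationCk … 2 (r x₀) τ → 0` controls
  `Ψ^* g − g_B` in `C⁰` (`enorm_deviation_le_truncDeviationCk`);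
* `immortal_or_pastGoing`: for a general spacetime with a Cauchy hypersurface and a general
  reference background stationary along a line, the pushed line is eventually uniformly timelike,
  of one time orientation; in the future case it is future endless
  (`TimeOrientation.isFutureEndless_Ici_of_val_velocity_le`), hence eventually in `J⁺(S)`
  (`IsCauchyHypersurface.exists_forall_mem_causalFuture_of_isFutureEndless`), monotone along its
  own segments and of unbounded length (`arcLength_le_lorentzDist`);
* the registered statement follows for `𝒟.toSpacetime` and `S = range 𝒟.embed`.
-/

open scoped Manifold ContDiff Topology ENNReal NNReal
open Set Filter Bundle Metric MeasureTheory
open Literature.Geometry.Lorentzian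

set_option linter.dupNamespace false
-- instance search on the nested operator space `E →L[ℝ] E →L[ℝ] ℝ` needs one more pending level
set_option maxSynthPendingDepth 2

noncomputable section

namespace Summit.FinalStateConjecture.FinalStateConjecture.Theorems.PhotonSphereChannels.TameCensorshipCrush

/-- A continuous real function without zeros on a ray has one sign there (intermediate value
theorem). [folklore] -/
theorem forall_neg_or_forall_pos_of_ne_zero {f : ℝ → ℝ} {a : ℝ} (hf : ContinuousOn f (Ici a))
    (hne : ∀ s, a ≤ s → f s ≠ 0) :
    (∀ s, a ≤ s → f s < 0) ∨ (∀ s, a ≤ s → 0 < f s) := by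
  rcases lt_or_gt_of_ne (hne a le_rfl) with ha | ha
  · refine Or.inl fun s hs ↦ ?_
    by_contra h
    obtain ⟨c, hc, hfc⟩ :=
      intermediate_value_Icc hs (hf.mono Icc_subset_Ici_self) ⟨ha.le, not_lt.mp h⟩
    exact hne c hc.1 hfc
  · refine Or.inr fun s hs ↦ ?_
    by_contra h
    obtain ⟨c, hc, hfc⟩ :=
      intermediate_value_Icc' hs (hf.mono Icc_subset_Ici_self) ⟨not_lt.mp h, ha.le⟩
    exact hne c hc.1 hfc

/-! ### The Killing orbit of the boosted Kerr–Schild background -/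

section Orbit

/-- Rest-frame coordinates of the translate `x + s Λe₀`: `Λ⁻¹(x + sΛe₀ − c) = Λ⁻¹(x − c) + s e₀`
(O'Neill 1983, Ch. 9, p. 236: Poincaré maps are affine). [folklore] -/
theorem poincareInv_add_smul (Λ : lorentzGroup) (c x : E4) (s : ℝ) :
    poincareInv Λ c (x + s • (Λ : E4 ≃L[ℝ] E4) (EuclideanSpace.single (0 : Fin 4) (1 : ℝ))) =
      poincareInv Λ c x + s • E4.basisVector 0 := by
  simp only [poincareInv, E4.basisVector]
  rw [show x + s • (Λ : E4 ≃L[ℝ] E4) (EuclideanSpace.single (0 : Fin 4) (1 : ℝ)) - c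
      = (x - c) + s • (Λ : E4 ≃L[ℝ] E4) (EuclideanSpace.single (0 : Fin 4) (1 : ℝ)) by abel,
    map_add, map_smul, ContinuousLinearEquiv.symm_apply_apply]

/-- Along the Killing orbit the rest-frame time advances by `s`: `t*(x + sΛe₀) = t*(x) + s`
(Kerr–Schild 1965; O'Neill 1995, Ch. 2, §2.2). [folklore] -/
theorem time_add_smul (Λ : lorentzGroup) (c : E4) (M a : ℝ) (x : E4) (s : ℝ) :
    (boostedKerrBackground Λ c M a).time
        (x + s • (Λ : E4 ≃L[ℝ] E4) (EuclideanSpace.single (0 : Fin 4) (1 : ℝ))) =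
      (boostedKerrBackground Λ c M a).time x + s := by
  show poincareInv Λ c _ 0 = poincareInv Λ c x 0 + s
  rw [poincareInv_add_smul]
  simp [E4.basisVector]

/-- Along the Killing orbit the rest-frame Kerr–Schild radius is constant
(`Kerr.radius_add_time_smul_basisVector`). [folklore] -/
theorem radius_add_smul (Λ : lorentzGroup) (c : E4) (M a : ℝ) (x : E4) (s : ℝ) :
    (boostedKerrBackground Λ c M a).radius
        (x + s • (Λ : E4 ≃L[ℝ] E4) (EuclideanSpace.single (0 : Fin 4) (1 : ℝ))) =
      (boostedKerrBackground Λ c M a).radius x := by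
  show Kerr.radius a (poincareInv Λ c _) = Kerr.radius a (poincareInv Λ c x)
  rw [poincareInv_add_smul, Kerr.radius_add_time_smul_basisVector]

/-- **Stationarity of the boosted Kerr–Schild form along the Killing orbit**:
`g_B(x + sΛe₀) = g_B(x)` (`Kerr.bilin_add_smul_basisVector_zero` transported by the Poincaré map).
Kerr–Schild 1965. [folklore] -/
theorem bilin_add_smul (Λ : lorentzGroup) (c : E4) (M a : ℝ) (x : E4) (s : ℝ) :
    (boostedKerrBackground Λ c M a).bilin
        (x + s • (Λ : E4 ≃L[ℝ] E4) (EuclideanSpace.single (0 : Fin 4) (1 : ℝ))) =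
      (boostedKerrBackground Λ c M a).bilin x := by
  show boostedKerrBilin Λ c M a _ = boostedKerrBilin Λ c M a x
  ext v w
  rw [boostedKerrBilin_apply, boostedKerrBilin_apply, poincareInv_add_smul,
    Kerr.bilin_add_smul_basisVector_zero]

-- the algebraic and the operator-norm instance paths on `E4 →L[ℝ] E4 →L[ℝ] ℝ` unify slowly
set_option synthInstance.maxHeartbeats 200000 in
/-- **`C⁰` control from the truncated `Cᵏ` deviation**: at a point of the truncated slab
`{t = τ, r ≤ R}` the operator norm of the metric deviation `Ψ^* g − g_B` is bounded by
`truncDeviationCk … k R τ` (the `m = 0` term of the `Cᵏ` sup norm). DHRT arXiv:2104.08222, §1.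
[folklore] -/
theorem enorm_deviation_le_truncDeviationCk {𝓢 : Spacetime 4} {B : ModelBackground}
    (Ψ : B.domain → 𝓢.carrier) (k : ℕ) {R τ : ℝ} {y : B.domain} (hy : y ∈ B.truncTimeSlab R τ) :
    ‖𝓢.deviation B Ψ y‖ₑ ≤ 𝓢.truncDeviationCk B Ψ k R τ := by
  have h := enorm_iteratedFDeriv_le_supCkENorm (Nat.zero_le k) (mem_image_of_mem Subtype.val hy)
    (𝓢.deviationExtend B Ψ)
  have h0 : ‖iteratedFDeriv ℝ 0 (𝓢.deviationExtend B Ψ) y.1‖ₑ = ‖𝓢.deviation B Ψ y‖ₑ := by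
    rw [← ofReal_norm, norm_iteratedFDeriv_zero, Spacetime.deviationExtend_coe, ofReal_norm]
  rw [h0] at h
  exact h

end Orbit

/-! ### Immortal observers in a spacetime with a Cauchy hypersurface -/

section Main

universe u

-- the algebraic and the operator-norm instance paths on `E4 →L[ℝ] E4 →L[ℝ] ℝ` unify slowly
set_option synthInstance.maxHeartbeats 200000 in
/-- **Late charts from a stationary background carry immortal observers, or run to the past**
(the stub for a general spacetime `𝓢` with a Cauchy hypersurface `S` and a general reference
background `B` which is stationary along the straight line `s ↦ x₀ + s e`: constant reference
form and radius, time advancing by `s`). For a smooth chart map `Ψ` with near-zone `C²` deviation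
`→ 0` and `g_B(x₀)(e, e) < 0`, the pushed line `γ s = Ψ(x₀ + s e)` is eventually a timelike curve
with `g(γ', γ') ≤ -k < 0` (`C⁰` control of `Ψ^* g − g_B` on the truncated slabs through the
line), of one time orientation (continuity of `g(T, γ')`); if future-directed it is future
endless (`TimeOrientation.isFutureEndless_Ici_of_val_velocity_le`), hence eventually in `J⁺(S)`
(`IsCauchyHypersurface.exists_forall_mem_causalFuture_of_isFutureEndless`), `≤`-monotone along its
own segments, and
of unbounded length (`arcLength_le_lorentzDist`); otherwise it is a future timelike curve for the
reversed orientation. O'Neill 1983, Ch. 14, Def. 14.15, Def. 14.28, Lemma 14.29. [folklore] -/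
theorem immortal_or_pastGoing (𝓢 : Spacetime.{u} 4) {S : Set 𝓢.carrier}
    (hS : 𝓢.metric.IsCauchyHypersurface 𝓢.timeOrientation S)
    (B : ModelBackground) (e : E4) (Ψ : B.domain → 𝓢.carrier)
    (hΨ : ContMDiff 𝓘(ℝ, E4) (𝓡 4) ∞ Ψ)
    (hdev : ∀ R : ℝ, Tendsto (fun τ => 𝓢.truncDeviationCk B Ψ 2 R τ) atTop (𝓝 0))
    (x₀ : B.domain) (γ : ℝ → 𝓢.carrier)
    (hdom : ∀ s : ℝ, (x₀ : E4) + s • e ∈ B.domain)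
    (hγ : ∀ s : ℝ, γ s = Ψ ⟨(x₀ : E4) + s • e, hdom s⟩)
    (htime : ∀ s : ℝ, B.time ((x₀ : E4) + s • e) = B.time x₀.1 + s)
    (hrad : ∀ s : ℝ, B.radius ((x₀ : E4) + s • e) = B.radius x₀.1)
    (hstat : ∀ s : ℝ, B.bilin ((x₀ : E4) + s • e) = B.bilin x₀.1)
    (hneg : B.bilin x₀.1 e e < 0) :
    (∃ s₀ : ℝ, ∀ s : ℝ, s₀ ≤ s →
        γ s ∈ 𝓢.metric.causalFuture 𝓢.timeOrientation S ∧
        (∀ s' : ℝ, s ≤ s' → γ s' ∈ 𝓢.metric.causalFuture 𝓢.timeOrientation {γ s}) ∧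
        ∀ τ : ℝ≥0, ∃ s' : ℝ, s ≤ s' ∧ (τ : ℝ≥0∞) < 𝓢.lorentzDist (γ s) (γ s')) ∨
    ∃ s₀ : ℝ, 𝓢.metric.IsFutureTimelikeCurveOn 𝓢.timeOrientation.reverse γ (Set.Ici s₀) := by
  -- Step 0: the background line `cc` and `γ = Ψ ∘ cc`
  set cc : ℝ → B.domain := fun s ↦ ⟨(x₀ : E4) + s • e, hdom s⟩ with hcc_def
  have hγeq : γ = fun s ↦ Ψ (cc s) := funext hγ
  subst hγeq
  have h2n : (2 : ℕ∞ω) ≤ ((⊤ : ℕ∞) : ℕ∞ω) := WithTop.coe_le_coe.mpr le_top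
  have h1n : (1 : ℕ∞ω) ≤ ((⊤ : ℕ∞) : ℕ∞ω) := WithTop.coe_le_coe.mpr le_top
  -- Step 1: smoothness and velocity of the pushed line
  have hline : ContDiff ℝ ∞ (fun s : ℝ ↦ (x₀ : E4) + s • e) :=
    contDiff_const.add (contDiff_id.smul contDiff_const)
  have hcc : ContMDiff 𝓘(ℝ, ℝ) 𝓘(ℝ, E4) ∞ cc := by
    rw [← ContMDiff.subtypeVal_comp_iff]
    exact hline.contMDiff
  have hΓ : ContMDiff 𝓘(ℝ, ℝ) (𝓡 4) ∞ (fun s ↦ Ψ (cc s)) := by exact hΨ.comp hcc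
  have hmdΨ : ∀ y, MDifferentiableAt 𝓘(ℝ, E4) (𝓡 4) Ψ y := fun y ↦
    hΨ.mdifferentiableAt (by simp)
  have hmdcc : ∀ s, MDifferentiableAt 𝓘(ℝ, ℝ) 𝓘(ℝ, E4) cc s := fun s ↦
    hcc.mdifferentiableAt (by simp)
  have hmd : ∀ s, MDifferentiableAt 𝓘(ℝ, ℝ) (𝓡 4) (fun s ↦ Ψ (cc s)) s := fun s ↦
    hΓ.mdifferentiableAt (by simp)
  have hvel : ∀ s, (velocity (𝓡 4) (fun s ↦ Ψ (cc s)) s : E4) =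
      mfderiv 𝓘(ℝ, E4) (𝓡 4) Ψ (cc s) e := by
    intro s
    have hd : HasDerivAt (fun s : ℝ ↦ (x₀ : E4) + s • e) e s := by
      simpa using ((hasDerivAt_id s).smul_const e).const_add (x₀ : E4)
    have hmf : HasMFDerivAt 𝓘(ℝ, ℝ) 𝓘(ℝ, E4) (Subtype.val ∘ cc) s
        (ContinuousLinearMap.toSpanSingleton ℝ e) :=
      hasMFDerivAt_iff_hasFDerivAt.mpr hd.hasFDerivAt
    have h5 : ContinuousLinearMap.toSpanSingleton ℝ e (1 : ℝ) = e := by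
      rw [ContinuousLinearMap.toSpanSingleton_apply, one_smul]
    have hvcc : (velocity 𝓘(ℝ, E4) cc s : E4) = e := by
      rw [← velocity_subtypeVal_comp B.domain cc s]
      unfold velocity
      rw [hmf.mfderiv]
      exact h5
    have h := mfderiv_comp s (hmdΨ (cc s)) (hmdcc s)
    unfold velocity
    change mfderiv 𝓘(ℝ, ℝ) (𝓡 4) (Ψ ∘ cc) s 1 = _
    rw [h]
    exact congrArg (mfderiv 𝓘(ℝ, E4) (𝓡 4) Ψ (cc s)) hvcc
  -- Step 2: the line lies in the truncated slabs `{t = t(x₀) + s, r ≤ r(x₀)}`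
  have hslab : ∀ s, cc s ∈ B.truncTimeSlab (B.radius x₀.1) (B.time x₀.1 + s) := fun s ↦
    ⟨htime s, (hrad s).le⟩
  -- Step 3: `C⁰` smallness of the deviation along the line, eventually
  set q : ℝ := B.bilin x₀.1 e e with hq_def
  have hq : q < 0 := hneg
  set k : ℝ := -q / 2 with hk_def
  have hk : 0 < k := by rw [hk_def]; linarith
  set δ : ℝ := k / (‖e‖ ^ 2 + 1) with hδ_def
  have hδ : 0 < δ := by positivity
  have hδe : δ * ‖e‖ ^ 2 ≤ k := by
    rw [hδ_def, div_mul_eq_mul_div, div_le_iff₀ (by positivity)]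
    nlinarith [sq_nonneg ‖e‖]
  obtain ⟨N, hN⟩ := (ENNReal.tendsto_atTop_zero.mp (hdev (B.radius x₀.1))) (ENNReal.ofReal δ)
    (ENNReal.ofReal_pos.mpr hδ)
  set s₁ : ℝ := N - B.time x₀.1 with hs₁_def
  have hdevpt : ∀ s, s₁ ≤ s → ‖𝓢.deviation B Ψ (cc s)‖ ≤ δ := by
    intro s hs
    have h1 : ‖𝓢.deviation B Ψ (cc s)‖ₑ ≤
        𝓢.truncDeviationCk B Ψ 2 (B.radius x₀.1) (B.time x₀.1 + s) :=
      enorm_deviation_le_truncDeviationCk Ψ 2 (hslab s)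
    have h2 : 𝓢.truncDeviationCk B Ψ 2 (B.radius x₀.1) (B.time x₀.1 + s) ≤ ENNReal.ofReal δ :=
      hN (B.time x₀.1 + s) (by rw [hs₁_def] at hs; linarith)
    have h3 := h1.trans h2
    rw [← ofReal_norm, ENNReal.ofReal_le_ofReal_iff hδ.le] at h3
    exact h3
  -- Step 4: `g(γ', γ') ≤ -k` on `[s₁, ∞)`
  have hGs : ∀ s, s₁ ≤ s →
      𝓢.metric.val (Ψ (cc s)) (velocity (𝓡 4) (fun s ↦ Ψ (cc s)) s)
        (velocity (𝓡 4) (fun s ↦ Ψ (cc s)) s) ≤ -k := by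
    intro s hs
    rw [hvel s]
    have hdev_eq : 𝓢.deviation B Ψ (cc s) e e =
        𝓢.metric.val (Ψ (cc s)) (mfderiv 𝓘(ℝ, E4) (𝓡 4) Ψ (cc s) e)
          (mfderiv 𝓘(ℝ, E4) (𝓡 4) Ψ (cc s) e) - q := by
      rw [Spacetime.deviation_apply]
      congr 1
      show B.bilin ((x₀ : E4) + s • e) e e = q
      rw [hstat s]
    have hle : |𝓢.deviation B Ψ (cc s) e e| ≤ δ * ‖e‖ ^ 2 := by
      have h1 : |𝓢.deviation B Ψ (cc s) e e| ≤ ‖𝓢.deviation B Ψ (cc s)‖ * ‖e‖ * ‖e‖ := by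
        rw [← Real.norm_eq_abs]; exact (𝓢.deviation B Ψ (cc s)).le_opNorm₂ e e
      have h2 : ‖𝓢.deviation B Ψ (cc s)‖ * ‖e‖ * ‖e‖ ≤ δ * ‖e‖ ^ 2 := by
        rw [pow_two, ← mul_assoc]; gcongr; exact hdevpt s hs
      exact h1.trans h2
    have h3 := (abs_le.mp hle).2
    rw [hdev_eq] at h3
    have h4 : q + k = -k := by rw [hk_def]; ring
    linarith
  have htl : ∀ s, s₁ ≤ s → 𝓢.metric.IsTimelike (velocity (𝓡 4) (fun s ↦ Ψ (cc s)) s) :=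
    fun s hs ↦ by rw [LorentzianMetric.isTimelike_iff]; linarith [hGs s hs]
  -- Step 5: the sign of `g(T, γ')` is constant on `[s₁, ∞)`
  set f : ℝ → ℝ := fun s ↦ 𝓢.metric.val (Ψ (cc s)) (𝓢.timeOrientation.vectorField (Ψ (cc s)))
    (velocity (𝓡 4) (fun s ↦ Ψ (cc s)) s) with hf_def
  have hfc : Continuous f := by
    refine LorentzianMetric.continuous_val_of_continuous 𝓢.metric hΓ.continuous
      (V := fun s ↦ 𝓢.timeOrientation.vectorField (Ψ (cc s)))
      (W := fun s ↦ velocity (𝓡 4) (fun s ↦ Ψ (cc s)) s) ?_ ?_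
    · exact 𝓢.timeOrientation.contMDiff.continuous.comp hΓ.continuous
    · exact LorentzianMetric.continuous_tangentLift (hΓ.of_le h1n)
  have hfne : ∀ s, s₁ ≤ s → f s ≠ 0 := fun s hs ↦
    𝓢.metric.val_ne_zero_of_isTimelike_of_isCausal (𝓢.timeOrientation.isTimelike _)
      (htl s hs).isCausal
  rcases forall_neg_or_forall_pos_of_ne_zero hfc.continuousOn hfne with hfut | hpast
  · -- Case A: the line is future-directed on `[s₁, ∞)`
    have hcurve : 𝓢.metric.IsFutureTimelikeCurveOn 𝓢.timeOrientation (fun s ↦ Ψ (cc s))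
        (Ici s₁) :=
      fun s hs ↦ ⟨hmd s, htl s hs, (htl s hs).isCausal, hfut s hs⟩
    have hend : IsFutureEndless (fun s ↦ Ψ (cc s)) (Ici s₁) :=
      𝓢.timeOrientation.isFutureEndless_Ici_of_val_velocity_le h1n hk
        fun s hs ↦ ⟨hmd s, hGs s hs, (hcurve s hs).2.2⟩
    obtain ⟨s₂, hs₁₂, hJ⟩ :=
      hS.exists_forall_mem_causalFuture_of_isFutureEndless h2n hcurve hend
    refine Or.inl ⟨s₂, fun s hs ↦ ⟨hJ s hs, fun s' hss' ↦ ?_, fun τ ↦ ?_⟩⟩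
    · -- monotonicity along the line
      rcases hss'.eq_or_lt with h | hlt
      · rw [← h]
        exact LorentzianMetric.subset_causalFuture _ _ _ (mem_singleton _)
      · exact Or.inr ⟨Ψ (cc s), rfl, fun s ↦ Ψ (cc s), s, s', hlt,
          (hcurve.mono fun t ht ↦ (hs₁₂.trans hs).trans ht.1).isFutureCausalCurveOn, rfl, rfl⟩
    · -- unbounded length: the segment `[s, s + (τ + 1)/√k]` has length `≥ τ + 1`
      set L : ℝ := ((τ : ℝ) + 1) / Real.sqrt k with hL_def
      have hk' : 0 < Real.sqrt k := Real.sqrt_pos.mpr hk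
      have hL : 0 < L := by positivity
      have hkL : Real.sqrt k * (s + L - s) = (τ : ℝ) + 1 := by
        rw [add_sub_cancel_left, hL_def]
        field_simp
      refine ⟨s + L, by linarith, ?_⟩
      have hseg : 𝓢.metric.IsFutureCausalCurveOn 𝓢.timeOrientation (fun s ↦ Ψ (cc s))
          (Icc s (s + L)) :=
        (hcurve.mono fun t ht ↦ (hs₁₂.trans hs).trans ht.1).isFutureCausalCurveOn
      have hlen : ENNReal.ofReal (Real.sqrt k * (s + L - s)) ≤
          𝓢.metric.arcLength (fun s ↦ Ψ (cc s)) s (s + L) := by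
        refine PseudoRiemannianMetric.ofReal_mul_le_arcLength (Real.sqrt_nonneg k) fun t ht ↦ ?_
        have ht₁ : s₁ ≤ t := (hs₁₂.trans hs).trans ht.1
        rw [PseudoRiemannianMetric.speed_eq_sqrt_neg_of_nonpos (htl t ht₁).le]
        exact Real.sqrt_le_sqrt (by linarith [hGs t ht₁])
      calc ((τ : ℝ≥0) : ℝ≥0∞) = ENNReal.ofReal (τ : ℝ) := ENNReal.ofReal_coe_nnreal.symm
        _ < ENNReal.ofReal (Real.sqrt k * (s + L - s)) := by
            rw [ENNReal.ofReal_lt_ofReal_iff (by rw [hkL]; positivity), hkL]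
            exact lt_add_one _
        _ ≤ 𝓢.lorentzDist (Ψ (cc s)) (Ψ (cc (s + L))) :=
            hlen.trans (LorentzianMetric.arcLength_le_lorentzDist (by linarith) hseg rfl rfl)
  · -- Case B: the line is past-directed on `[s₁, ∞)`
    exact Or.inr ⟨s₁, fun s hs ↦ ⟨hmd s, htl s hs,
      (𝓢.timeOrientation.isFutureDirected_reverse_iff _).mpr ⟨(htl s hs).isCausal, hpast s hs⟩⟩⟩

end Main

/-! ### The registered stub -/

/-- **STUB O — late charts carry immortal observers (or run to the past)** (registered statement
of the line `crush-the-swallowed-interior`, verbatim). For ANY late chart `Ψ` of the Cauchy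
development `𝒟` from a boosted Kerr–Schild background `(Λ, c, M, a)` (either time orientation,
image anywhere) whose near-zone `C²` deviation tends to `0`, any background point `x₀` at which the
stationary Killing vector `Λe₀` is timelike for the background form, and the pushed orbit
`γ s = Ψ(x₀ + sΛe₀)`: EITHER `γ` is eventually in `J⁺(ιX)`, `≤`-monotone there, with
`ℝ≥0`-unbounded Lorentzian distance along it, OR `γ` is eventually a past-directed timelike curve.
Proof: `immortal_or_pastGoing` for the spacetime of `𝒟` and the Cauchy hypersurface `ιX = range
𝒟.embed` (`𝒟.isCauchyHypersurface`). O'Neill 1983, Ch. 14, Def. 14.28, Lemma 14.29;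
Kerr–Schild 1965. [folklore] -/
theorem stub_immortalObservers :
    ∀ (X : Type) [TopologicalSpace X] [ChartedSpace E3 X] [IsManifold (𝓡 3) ∞ X] [T2Space X]
      [SecondCountableTopology X] [ConnectedSpace X] (D : InitialDataSet (𝓡 3) X)
      (𝒟 : VacuumCauchyDevelopment D)
      (Λ : lorentzGroup) (c : E4) (M a : ℝ) (τ₀ : ℝ)
      (Ψ : (boostedKerrBackground Λ c M a).domain → 𝒟.carrier),
      𝒟.toSpacetime.IsLateChart (boostedKerrBackground Λ c M a) Set.univ τ₀ Ψ →
      (∀ R : ℝ, Tendsto (fun τ => 𝒟.toSpacetime.truncDeviationCk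
        (boostedKerrBackground Λ c M a) Ψ 2 R τ) atTop (𝓝 0)) →
      ∀ (x₀ : (boostedKerrBackground Λ c M a).domain) (γ : ℝ → 𝒟.carrier)
        (hdom : ∀ s : ℝ, (x₀ : E4) + s • (Λ : E4 ≃L[ℝ] E4) (EuclideanSpace.single (0 : Fin 4) (1 : ℝ)) ∈
          (boostedKerrBackground Λ c M a).domain),
        (∀ s : ℝ, γ s = Ψ ⟨(x₀ : E4) + s • (Λ : E4 ≃L[ℝ] E4) (EuclideanSpace.single (0 : Fin 4) (1 : ℝ)),
          hdom s⟩) →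
        (boostedKerrBackground Λ c M a).bilin x₀.1
            ((Λ : E4 ≃L[ℝ] E4) (EuclideanSpace.single (0 : Fin 4) (1 : ℝ)))
            ((Λ : E4 ≃L[ℝ] E4) (EuclideanSpace.single (0 : Fin 4) (1 : ℝ))) < 0 →
        (∃ s₀ : ℝ, ∀ s : ℝ, s₀ ≤ s →
            γ s ∈ 𝒟.metric.causalFuture 𝒟.timeOrientation (Set.range 𝒟.embed) ∧
            (∀ s' : ℝ, s ≤ s' → γ s' ∈ 𝒟.metric.causalFuture 𝒟.timeOrientation {γ s}) ∧
            ∀ τ : ℝ≥0, ∃ s' : ℝ, s ≤ s' ∧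
              (τ : ℝ≥0∞) < 𝒟.toSpacetime.lorentzDist (γ s) (γ s')) ∨
        ∃ s₀ : ℝ, 𝒟.metric.IsFutureTimelikeCurveOn 𝒟.timeOrientation.reverse γ (Set.Ici s₀) :=
  fun _ _ _ _ _ _ _ _ 𝒟 Λ c M a _ Ψ hΨ hdev x₀ γ hdom hγ hneg ↦
    immortal_or_pastGoing 𝒟.toSpacetime 𝒟.isCauchyHypersurface (boostedKerrBackground Λ c M a)
      ((Λ : E4 ≃L[ℝ] E4) (EuclideanSpace.single (0 : Fin 4) (1 : ℝ))) Ψ hΨ.contMDiff hdev x₀ γ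
      hdom hγ (time_add_smul Λ c M a x₀.1) (radius_add_smul Λ c M a x₀.1)
      (bilin_add_smul Λ c M a x₀.1) hneg

end Summit.FinalStateConjecture.FinalStateConjecture.Theorems.PhotonSphereChannels.TameCensorshipCrush

end
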